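import Mathlib
import Summits.KontsevichZagierPeriods.Zeta5Search.ThirdOrderDigit
import Summits.KontsevichZagierPeriods.Zeta5Search.SecondOrderTypes
import HarnessLib

/-!
# ζ(5) search — the SHAPE of an admissible double raise (`isRaise2`) on the levels (tools for gen-2 g10's THEOREM A⁗, P2)

Cell `pub-zeta5` (HONEST FRAMING: systematic search; no irrationality claim unless certified), typer seat generation 12.
`SecondOrderTypes.isRaise_level` (typer g11) turned the Boolean list predicate `isRaise T S` into exponent FUNCTIONS on the levels
(`raiseAt`, `consOne`, `snocOne`).  Here the same for the double raises `isRaise2 T S` of `ThirdOrderDigit.lean` (hypothesis (T3)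
of `LawA4`): the six shapes `T+δ_a+δ_c`, `1::(T+δ_a)`, `(T+δ_a)++[1]`, `2::T`, `T++[2]`, `1::(T++[1])` become
`raiseAt (raiseAt e a) c`, `consOne (raiseAt e a)`, `snocOne (raiseAt e a) L`, `raiseAt (consOne e) 0`,
`raiseAt (snocOne e L) (L+1)`, `consOne (snocOne e L)` (`isRaise2_level`).  List bookkeeping only; nothing here bears on irrationality.
-/

namespace Summit.KontsevichZagierPeriods.Zeta5Search.SecondOrder

open Summit.KontsevichZagierPeriods.Zeta5Search.ClusterValuation (levelData_of_map_eq)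

/-- `raiseAtList` of a level list is the level list of `raiseAt`. -/
theorem raiseAtList_range_map (e : ℕ → ℤ) (L k : ℕ) :
    raiseAtList ((List.range (L + 1)).map e) k = (List.range (L + 1)).map (raiseAt e k) := by
  unfold raiseAtList; exact mapIdx_range_map e L k

/-- `2 :: T` on the levels: the raise at level `0` of `1 :: T`. -/
theorem consTwo_range_map (e : ℕ → ℤ) (L : ℕ) :
    (2 : ℤ) :: (List.range (L + 1)).map e = (List.range (L + 1 + 1)).map (raiseAt (consOne e) 0) := by
  have h := cons_range_map e L
  apply List.ext_getElem
  · simp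
  · intro i h1 h2
    have hlen : ((1 : ℤ) :: (List.range (L + 1)).map e).length = ((List.range (L + 1 + 1)).map (consOne e)).length := by rw [h]
    rcases i with _ | i
    · simp [raiseAt, consOne]
    · have hi := List.getElem_of_eq h (i := i + 1) (by simpa using h1)
      simp only [List.getElem_cons_succ, List.getElem_map, List.getElem_range] at hi ⊢
      rw [hi, raiseAt, if_neg (by omega)]

/-- `T ++ [2]` on the levels: the raise at level `L+1` of `T ++ [1]`. -/
theorem snocTwo_range_map (e : ℕ → ℤ) (L : ℕ) :
    (List.range (L + 1)).map e ++ [2] = (List.range (L + 1 + 1)).map (raiseAt (snocOne e L) (L + 1)) := by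
  conv_rhs => rw [List.range_succ, List.map_append, List.map_singleton]
  congr 1
  · refine List.map_congr_left fun i hi => ?_
    have := List.mem_range.1 hi
    simp [raiseAt, snocOne, show i ≠ L + 1 by omega]
  · simp [raiseAt, snocOne]

/-- `1 :: (T ++ [1])` on the levels. -/
theorem consSnoc_range_map (e : ℕ → ℤ) (L : ℕ) :
    (1 : ℤ) :: ((List.range (L + 1)).map e ++ [1]) = (List.range (L + 1 + 1 + 1)).map (consOne (snocOne e L)) := by
  rw [snoc_range_map, cons_range_map]

/-- **The shape of a doubly raised class.**  If `isRaise2 T S` holds for the level lists `T = [e₀,…,e_L]` and `S = [f₀,…,f_M]`,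
then `S` is one of the six level shapes. -/
theorem isRaise2_level {e f : ℕ → ℤ} {L M : ℕ}
    (h : isRaise2 ((List.range (L + 1)).map e) ((List.range (M + 1)).map f) = true) :
    (∃ a ≤ L, ∃ c ≤ L, M = L ∧ ∀ i ≤ L, f i = raiseAt (raiseAt e a) c i) ∨
      (∃ a ≤ L, M = L + 1 ∧ ∀ i ≤ L + 1, f i = consOne (raiseAt e a) i) ∨
      (∃ a ≤ L, M = L + 1 ∧ ∀ i ≤ L + 1, f i = snocOne (raiseAt e a) L i) ∨
      (M = L + 1 ∧ ∀ i ≤ L + 1, f i = raiseAt (consOne e) 0 i) ∨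
      (M = L + 1 ∧ ∀ i ≤ L + 1, f i = raiseAt (snocOne e L) (L + 1) i) ∨
      (M = L + 1 + 1 ∧ ∀ i ≤ L + 1 + 1, f i = consOne (snocOne e L) i) := by
  unfold isRaise2 at h
  simp only [Bool.or_eq_true, List.any_eq_true, beq_iff_eq, List.mem_range, List.length_map, List.length_range] at h
  rcases h with (((⟨a, ha, c, hc, hS⟩ | ⟨a, ha, hS | hS⟩) | hS) | hS) | hS
  · rw [raiseAtList_range_map, raiseAtList_range_map] at hS
    obtain ⟨hML, hi⟩ := levelData_of_map_eq hS
    exact Or.inl ⟨a, by omega, c, by omega, hML, fun i hi' => hi i (by omega)⟩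
  · rw [raiseAtList_range_map, cons_range_map] at hS
    obtain ⟨hML, hi⟩ := levelData_of_map_eq hS
    exact Or.inr (Or.inl ⟨a, by omega, hML, fun i hi' => hi i (by omega)⟩)
  · rw [raiseAtList_range_map, snoc_range_map] at hS
    obtain ⟨hML, hi⟩ := levelData_of_map_eq hS
    exact Or.inr (Or.inr (Or.inl ⟨a, by omega, hML, fun i hi' => hi i (by omega)⟩))
  · rw [consTwo_range_map] at hS
    obtain ⟨hML, hi⟩ := levelData_of_map_eq hS
    exact Or.inr (Or.inr (Or.inr (Or.inl ⟨hML, fun i hi' => hi i (by omega)⟩)))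
  · rw [snocTwo_range_map] at hS
    obtain ⟨hML, hi⟩ := levelData_of_map_eq hS
    exact Or.inr (Or.inr (Or.inr (Or.inr (Or.inl ⟨hML, fun i hi' => hi i (by omega)⟩))))
  · rw [consSnoc_range_map] at hS
    obtain ⟨hML, hi⟩ := levelData_of_map_eq hS
    exact Or.inr (Or.inr (Or.inr (Or.inr (Or.inr ⟨hML, fun i hi' => hi i (by omega)⟩))))

end Summit.KontsevichZagierPeriods.Zeta5Search.SecondOrder
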